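import Mathlib.Combinatorics.SimpleGraph.Walk.Counting
import Mathlib.Combinatorics.SimpleGraph.Paths
import Mathlib.Combinatorics.SimpleGraph.DeleteEdges
import Summits.CriticalPhenomena.SAWScalingLimit.Theorems.SAWTotalPositivityBoundaryTP2Defs
import HarnessLib

/-!
# Crux `BoundaryTP2` (stmt-CriticalPhenomena-7115), line `renewal-cauchy-binet`: gluing across two cut darts

The walk surgery behind the cut-pair sign lemma (`cutPairSign_core`,
`SAWTotalPositivityBoundaryTP2CutPairSign.lean`). Let `(A, Aᶜ)` be a vertex cut of a graph `H`, let
`G_A, G_B ≤ H` be graphs all of whose edges end inside, resp. outside, `A` (the two sides of the cut), and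
let `u → v`, `u' → v'` be darts of `H` with `u ∈ A`, `v' ∉ A`. If `p₁ ∈ A`, `p₂ ∉ A` and there are
vertex-disjoint self-avoiding paths `P : p₁ → u'`, `P' : u → p₄` of `G_A` and vertex-disjoint self-avoiding
paths `Q : p₂ → v`, `Q' : v' → p₃` of `G_B`, then `P · u'v' · Q'` and `Q · vu · P'` are vertex-disjoint
self-avoiding paths `p₁ → p₃` and `p₂ → p₄` of `H`; so this configuration is impossible when the quadruple
`p₁ p₂ p₃ p₄` is interlaced in `H` (`cutPair_false_of_glue`: LGV-type switching is legal across two cut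
darts). Everything here is proved; Mathlib only. [folklore]
-/

noncomputable section

namespace Summit.CriticalPhenomena.SAWScalingLimit.Theorems.BoundaryTP2

variable {V : Type*}

/-- If every edge of `G` ends in `P`, a walk of `G` that starts in `P` stays in `P`. [folklore] -/
-- adapted from `forall_mem_support` in `SAWTotalPositivityBoundaryTP2TwoEdgeCut.lean`
private theorem support_subset_of_start {G : SimpleGraph V} {P : V → Prop}
    (hG : ∀ a b, G.Adj a b → P b) {a b : V} (p : G.Walk a b) (ha : P a) :
    ∀ z ∈ p.support, P z := by
  induction p with
  | nil =>
    intro z hz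
    rw [SimpleGraph.Walk.support_nil, List.mem_singleton] at hz
    exact hz ▸ ha
  | cons h q ih =>
    intro z hz
    rw [SimpleGraph.Walk.support_cons, List.mem_cons] at hz
    rcases hz with rfl | hz
    · exact ha
    · exact ih (hG _ _ h) z hz

/-- **Gluing across a dart.** A self-avoiding path inside `P`, a dart, and a self-avoiding path outside
`P` glue to a self-avoiding path. [folklore] -/
-- adapted from `exists_glue` (`hglue`) in `SAWTotalPositivityBoundaryTP2TwoEdgeCut.lean`
private theorem isPath_glue {H : SimpleGraph V} {P : V → Prop} {a b c d : V} (p : H.Walk a b)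
    (hbc : H.Adj b c) (q : H.Walk c d) (hp : p.IsPath) (hq : q.IsPath)
    (hpP : ∀ z ∈ p.support, P z) (hqP : ∀ z ∈ q.support, ¬ P z) :
    (p.append (SimpleGraph.Walk.cons hbc q)).IsPath := by
  rw [SimpleGraph.Walk.isPath_def, SimpleGraph.Walk.support_append, SimpleGraph.Walk.support_cons,
    List.tail_cons]
  refine List.nodup_append.2 ⟨hp.support_nodup, hq.support_nodup, ?_⟩
  intro z hz z' hz' hzz'
  exact hqP z' hz' (hzz' ▸ hpP z hz)

/-- **Two cut darts and four side paths contradict interlacing.** Let `G_A, G_B ≤ H` have all their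
edges ending inside, resp. outside, `A`; let `u → v`, `u' → v'` be darts of `H` with `u ∈ A`, `v' ∉ A`,
and `p₁ ∈ A`, `p₂ ∉ A`. Vertex-disjoint self-avoiding paths `P : p₁ → u'`, `P' : u → p₄` of `G_A` and
`Q : p₂ → v`, `Q' : v' → p₃` of `G_B` glue to the vertex-disjoint self-avoiding paths `P · u'v' · Q'`
(`p₁ → p₃`) and `Q · vu · P'` (`p₂ → p₄`) of `H` (the side-`A` pieces lie in `A`, the side-`B` pieces
outside) — impossible if `p₁ p₂ p₃ p₄` is interlaced in `H`. [folklore] -/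
theorem cutPair_false_of_glue {V : Type*} {H GA GB : SimpleGraph V} {A : Set V}
    {p₁ p₂ p₃ p₄ u v u' v' : V} (hAle : GA ≤ H) (hBle : GB ≤ H) (hA' : ∀ a b, GA.Adj a b → b ∈ A)
    (hB' : ∀ a b, GB.Adj a b → b ∉ A) (hI : Interlaced H p₁ p₂ p₃ p₄) (huv : H.Adj u v)
    (hu'v' : H.Adj u' v') (h₁ : p₁ ∈ A) (hu : u ∈ A) (h₂ : p₂ ∉ A) (hv' : v' ∉ A)
    (P : GA.Walk p₁ u') (P' : GA.Walk u p₄) (hP : P.IsPath) (hP' : P'.IsPath)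
    (hPP' : List.Disjoint P.support P'.support) (Q : GB.Walk p₂ v) (Q' : GB.Walk v' p₃)
    (hQ : Q.IsPath) (hQ' : Q'.IsPath) (hQQ' : List.Disjoint Q.support Q'.support) : False := by
  have hPA : ∀ z ∈ P.support, z ∈ A := support_subset_of_start (P := fun z => z ∈ A) hA' P h₁
  have hP'A : ∀ z ∈ P'.support, z ∈ A := support_subset_of_start (P := fun z => z ∈ A) hA' P' hu
  have hQB : ∀ z ∈ Q.support, z ∉ A := support_subset_of_start (P := fun z => z ∉ A) hB' Q h₂
  have hQ'B : ∀ z ∈ Q'.support, z ∉ A := support_subset_of_start (P := fun z => z ∉ A) hB' Q' hv'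
  -- the glued self-avoiding paths `p₁ → p₃` and `p₂ → p₄` of `H`
  have hγ₁ : ((P.mapLe hAle).append (SimpleGraph.Walk.cons hu'v' (Q'.mapLe hBle))).IsPath :=
    isPath_glue (P := fun z => z ∈ A) _ hu'v' _ (hP.mapLe hAle) (hQ'.mapLe hBle)
      (by rw [SimpleGraph.Walk.support_mapLe_eq_support]; exact hPA)
      (by rw [SimpleGraph.Walk.support_mapLe_eq_support]; exact hQ'B)
  have hγ₂ : ((Q.mapLe hBle).append (SimpleGraph.Walk.cons huv.symm (P'.mapLe hAle))).IsPath :=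
    isPath_glue (P := fun z => z ∉ A) _ huv.symm _ (hQ.mapLe hBle) (hP'.mapLe hAle)
      (by rw [SimpleGraph.Walk.support_mapLe_eq_support]; exact hQB)
      (by rw [SimpleGraph.Walk.support_mapLe_eq_support]; exact fun z hz h => h (hP'A z hz))
  obtain ⟨w, hw₁, hw₂⟩ := hI ⟨_, hγ₁⟩ ⟨_, hγ₂⟩
  simp only [SimpleGraph.Walk.mem_support_append_iff, SimpleGraph.Walk.support_mapLe_eq_support,
    SimpleGraph.Walk.support_cons, List.mem_cons] at hw₁ hw₂
  -- `hw₁ : w ∈ P ∨ w = u' ∨ w ∈ Q'`, `hw₂ : w ∈ Q ∨ w = v ∨ w ∈ P'`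
  rcases hw₁ with hw₁ | rfl | hw₁
  · rcases hw₂ with hw₂ | rfl | hw₂
    · exact hQB w hw₂ (hPA w hw₁)
    · exact hQB _ Q.end_mem_support (hPA _ hw₁)
    · exact hPP' hw₁ hw₂
  · rcases hw₂ with hw₂ | hw₂ | hw₂
    · exact hQB _ hw₂ (hPA _ P.end_mem_support)
    · exact hQB _ Q.end_mem_support (hw₂ ▸ hPA _ P.end_mem_support)
    · exact hPP' P.end_mem_support hw₂
  · rcases hw₂ with hw₂ | rfl | hw₂
    · exact hQQ' hw₂ hw₁
    · exact hQQ' Q.end_mem_support hw₁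
    · exact hQ'B w hw₁ (hP'A w hw₂)

end Summit.CriticalPhenomena.SAWScalingLimit.Theorems.BoundaryTP2

end
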